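/-
Copyright: seat `ym-line-sll-p3` (prover-ym-line-sll-p3-g0-0), route `SoftLoopLongLag`, crux `SoftLoopLagFloorToTorus`
(stmt-QuantumFields-22504), line `birth` (skeleton `Cruxes/SoftLoopLagFloorToTorus/Lines/birth.lean`).
-/
import Summits.QuantumFields.YangMills.Theorems.SoftLoopLongLagSoftLoopLagFloorToTorusStubDlrTransferG
import Summits.QuantumFields.YangMills.Theorems.ColdBoxAllGroupsBulkAllGroupsStubLargeFieldRarityG

/-!
# Crux `SoftLoopLagFloorToTorus` (stmt-QuantumFields-22504), line `birth` — kernel cold-typicality is TORUS-TYPICAL for free: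
# part 1 of 2 (a continuous over-indicator of the hot event; Markov + DLR + the landed torus large-field rarity)

WHY.  The line's stub K3 `stub_coldKernelTypicalG` asks, for EVERY crude-good datum `η`, that the box kernel `γ_η = γ_{Λ_n}(·|η)`
charge the hot event `coldᶜ = {∃ p touching Λ_n, c_p > β^{κ−1}}` by `≤ e^{−β^δ}`, with the threshold exponent `κ` independent of the
box exponent `a` (indeed T′'s line chooses `κ ≤ ε = a/8`).  Pointwise in `η` and below the box-entropy scale (`β^κ ≪ β^{4a} log β`)
this is the large-field problem in a polynomial box — crux-sized.  But the transfer K1 only ever uses typicality OFF a set of data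
of small TORUS mass, and that much is free: by Markov's inequality, the DLR equations and the landed torus rarity
(`stub_largeFieldRarityG`, every `δ > 0`), the data `η = lift U` whose kernel charges the hot event by more than `e` have torus
mass `≤ e⁻¹ · E_torus[γ_{lift}(Φ)] = e⁻¹ · E_torus[Φ ∘ lift] ≤ e⁻¹ · #{p} · e^{−β^{δ'}}`, where `Φ ≥ 𝟙_{coldᶜ}` is a continuous ramp
between the thresholds `β^{2δ'−1} < β^{κ−1}` (`2δ < 2δ' := (κ+2δ)/2 < κ`).  Part 2 (`…DlrTransferNoTypicalityG`) then proves
K1⁺ = K1 WITHOUT the typicality hypothesis (and without the rarity hypothesis, landed anyway): the line needs no K3.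

WHAT (every compact `G`, `r : LatticeRep G`; objects of `Theorems/SoftLoopLongLagDefs.lean`):
* §8 the ramp `Φ_{t',t}(W) = Σ_{p touching Λ} max 0 (min 1 ((c_p(W) − t')/(t − t')))`: continuous, `0 ≤ Φ ≤ #{p}`, cylinder on the
  collar, `Φ ≥ 1` off the cold event at threshold `t` (`t' < t`), each term `≤ 𝟙{t' ≤ c_p}`; hence `γ_η(coldᶜ) ≤ ∫ Φ dγ_η`;
* §9 `measureReal_kernelRamp_gt_le` — for torus sides `L + 1 > 2(n + 6R + 2)` and `e > 0`:
  `μ_{L+1}{U : e < ∫ Φ dγ_{lift U}} ≤ 16(2n+3)⁴ · e^{−β^{δ'}} / e` whenever every single-plaquette indicator `𝟙{β^{2δ'−1} ≤ c_p}` has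
  torus expectation `≤ e^{−β^{δ'}}` (the body of `PlaquetteLargeFieldRarityG r.ρ δ'` at `β`, `L`).

HONEST LABEL: rung R2xi-G RECORD label (leaf `WeakCouplingRates.XiPow`, an UPPER bound on the lattice mass gap); NOT the Clay mass
gap; no summit statement is touched.

References: H.-O. Georgii, *Gibbs Measures and Phase Transitions* (2011) Thm. 4.17 (DLR consistency); R. Durrett (2019) §1.6
(Markov's inequality); J. Fröhlich, R. Israel, E. H. Lieb, B. Simon, CMP 62 (1978) Thm. 4.1 (chessboard estimate, via the tree).
-/

set_option autoImplicit false

noncomputable section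

open MeasureTheory Filter Topology
open Literature.Probability.LatticeModels (Site box mem_box box_mono)
open Literature.MathematicalPhysics Literature.MathematicalPhysics.QuantumFieldTheory
open Literature.MathematicalPhysics.QuantumLattice
open Summit.QuantumFields.YangMills.Theorems.WeakCouplingRates
open Summit.QuantumFields.YangMills.Theorems.ColdBoxAllGroups (continuous_plaqCostAtG measurable_plaqCostAtG
  measureReal_setOf_le_plaqCostAt_eqG)

namespace Summit.QuantumFields.YangMills.Theorems.SoftLoopLongLag

/-! ### §8. A continuous over-indicator of the hot event -/

section Ramp

variable {G : Type} [Group G] [TopologicalSpace G] [IsTopologicalGroup G] [CompactSpace G]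
  [MeasurableSpace G] [BorelSpace G]

omit [IsTopologicalGroup G] [CompactSpace G] [MeasurableSpace G] [BorelSpace G] in
/-- One ramp term lies in `[0, 1]`. [folklore] -/
theorem rampTerm_mem (r : LatticeRep G) (t t' : ℝ) (p : ZdPlaquette 4) (W : LGConfig 4 G) :
    0 ≤ max 0 (min 1 ((plaqCostAt r.ρ p.1 p.2.1.1 p.2.1.2 W - t') / (t - t'))) ∧
      max 0 (min 1 ((plaqCostAt r.ρ p.1 p.2.1.1 p.2.1.2 W - t') / (t - t'))) ≤ 1 :=
  ⟨le_max_left _ _, max_le zero_le_one (min_le_left _ _)⟩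

omit [IsTopologicalGroup G] [CompactSpace G] [MeasurableSpace G] [BorelSpace G] in
/-- One ramp term is dominated by the indicator of `{t' ≤ c_p}` (`t' < t`). [folklore] -/
theorem rampTerm_le_indicator (r : LatticeRep G) {t t' : ℝ} (htt : t' < t) (p : ZdPlaquette 4) (W : LGConfig 4 G) :
    max 0 (min 1 ((plaqCostAt r.ρ p.1 p.2.1.1 p.2.1.2 W - t') / (t - t'))) ≤
      if t' ≤ plaqCostAt r.ρ p.1 p.2.1.1 p.2.1.2 W then (1 : ℝ) else 0 := by
  split_ifs with h
  · exact (rampTerm_mem r t t' p W).2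
  · rw [not_le] at h
    exact max_le le_rfl ((min_le_right _ _).trans (div_neg_of_neg_of_pos (by linarith) (by linarith)).le)

omit [IsTopologicalGroup G] [CompactSpace G] [MeasurableSpace G] [BorelSpace G] in
/-- One ramp term equals `1` once `c_p ≥ t` (`t' < t`). [folklore] -/
theorem rampTerm_eq_one_of_le (r : LatticeRep G) {t t' : ℝ} (htt : t' < t) (p : ZdPlaquette 4) (W : LGConfig 4 G)
    (hW : t ≤ plaqCostAt r.ρ p.1 p.2.1.1 p.2.1.2 W) :
    max 0 (min 1 ((plaqCostAt r.ρ p.1 p.2.1.1 p.2.1.2 W - t') / (t - t'))) = 1 := by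
  have h1 : 1 ≤ (plaqCostAt r.ρ p.1 p.2.1.1 p.2.1.2 W - t') / (t - t') := by
    rw [le_div_iff₀ (by linarith)]
    linarith
  rw [min_eq_left h1, max_eq_right zero_le_one]

omit [IsTopologicalGroup G] [CompactSpace G] [MeasurableSpace G] [BorelSpace G] in
/-- The ramp is non-negative and at most the number of plaquettes touching `Λ`. [folklore] -/
theorem ramp_nonneg_le_card (r : LatticeRep G) (t t' : ℝ) (Λ : Finset (QuantumLattice.ZdEdge 4)) (W : LGConfig 4 G) :
    0 ≤ ∑ p ∈ plaquettesTouching Λ, max 0 (min 1 ((plaqCostAt r.ρ p.1 p.2.1.1 p.2.1.2 W - t') / (t - t'))) ∧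
      ∑ p ∈ plaquettesTouching Λ, max 0 (min 1 ((plaqCostAt r.ρ p.1 p.2.1.1 p.2.1.2 W - t') / (t - t'))) ≤
        ((plaquettesTouching Λ).card : ℝ) := by
  refine ⟨Finset.sum_nonneg fun p _ => (rampTerm_mem r t t' p W).1, ?_⟩
  calc ∑ p ∈ plaquettesTouching Λ, max 0 (min 1 ((plaqCostAt r.ρ p.1 p.2.1.1 p.2.1.2 W - t') / (t - t')))
      ≤ ∑ _p ∈ plaquettesTouching Λ, (1 : ℝ) := Finset.sum_le_sum fun p _ => (rampTerm_mem r t t' p W).2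
    _ = ((plaquettesTouching Λ).card : ℝ) := by simp

omit [IsTopologicalGroup G] [CompactSpace G] [MeasurableSpace G] [BorelSpace G] in
/-- `|Φ| ≤ #{p touching Λ}`. [folklore] -/
theorem abs_ramp_le_card (r : LatticeRep G) (t t' : ℝ) (Λ : Finset (QuantumLattice.ZdEdge 4)) (W : LGConfig 4 G) :
    |∑ p ∈ plaquettesTouching Λ, max 0 (min 1 ((plaqCostAt r.ρ p.1 p.2.1.1 p.2.1.2 W - t') / (t - t')))| ≤
      ((plaquettesTouching Λ).card : ℝ) := by
  obtain ⟨h0, h1⟩ := ramp_nonneg_le_card r t t' Λ W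
  rw [abs_of_nonneg h0]
  exact h1

omit [IsTopologicalGroup G] [CompactSpace G] [MeasurableSpace G] [BorelSpace G] in
/-- Off the cold event at threshold `β^{κ−1} = t` the ramp is `≥ 1` (`t' < t`). [folklore] -/
theorem one_le_ramp_of_not_mem_coldEvent (r : LatticeRep G) {β κ t' : ℝ} (htt : t' < β ^ (κ - 1))
    (Λ : Finset (QuantumLattice.ZdEdge 4)) {W : LGConfig 4 G} (hW : W ∉ coldEvent r β κ Λ) :
    1 ≤ ∑ p ∈ plaquettesTouching Λ,
      max 0 (min 1 ((plaqCostAt r.ρ p.1 p.2.1.1 p.2.1.2 W - t') / (β ^ (κ - 1) - t'))) := by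
  simp only [coldEvent, Set.mem_setOf_eq, not_forall, not_le, exists_prop] at hW
  obtain ⟨p, hp, hlt⟩ := hW
  have h1 := rampTerm_eq_one_of_le r htt p W hlt.le
  calc (1 : ℝ) = max 0 (min 1 ((plaqCostAt r.ρ p.1 p.2.1.1 p.2.1.2 W - t') / (β ^ (κ - 1) - t'))) := h1.symm
    _ ≤ ∑ p ∈ plaquettesTouching Λ, max 0 (min 1 ((plaqCostAt r.ρ p.1 p.2.1.1 p.2.1.2 W - t') / (β ^ (κ - 1) - t'))) :=
        Finset.single_le_sum (fun q _ => (rampTerm_mem r _ t' q W).1) hp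

omit [CompactSpace G] [MeasurableSpace G] [BorelSpace G] in
/-- The ramp is continuous. [folklore] -/
theorem continuous_ramp (r : LatticeRep G) (t t' : ℝ) (Λ : Finset (QuantumLattice.ZdEdge 4)) :
    Continuous fun W : LGConfig 4 G =>
      ∑ p ∈ plaquettesTouching Λ, max 0 (min 1 ((plaqCostAt r.ρ p.1 p.2.1.1 p.2.1.2 W - t') / (t - t'))) :=
  continuous_finsetSum _ fun p _ =>
    continuous_const.max (continuous_const.min
      (((continuous_plaqCostAtG r.ρ r.continuous p.1 p.2.1.1 p.2.1.2).sub continuous_const).div_const _))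

omit [TopologicalSpace G] [IsTopologicalGroup G] [CompactSpace G] [MeasurableSpace G] [BorelSpace G] in
/-- A plaquette cost is a cylinder observable on the four edges of its plaquette. [folklore] -/
theorem isCylinder_plaqCostAt_plaquette {N : ℕ} (ρ : G →* Matrix (Fin N) (Fin N) ℂ) (p : ZdPlaquette 4) :
    IsCylinder (plaqCostAt ρ p.1 p.2.1.1 p.2.1.2) (plaquetteEdges p) := by
  intro U V hUV
  have h := isCylinder_plaquetteObs (G := G) ρ p hUV
  simp only [plaqCostAt]
  exact congrArg (fun x : ℝ => (N : ℝ) - x) h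

omit [IsTopologicalGroup G] [CompactSpace G] [MeasurableSpace G] [BorelSpace G] in
/-- The ramp is a cylinder observable on the collar of `Λ` (the edges of the plaquettes touching `Λ`). [folklore] -/
theorem isCylinder_ramp (r : LatticeRep G) (t t' : ℝ) (Λ : Finset (QuantumLattice.ZdEdge 4)) :
    IsCylinder (fun W : LGConfig 4 G =>
        ∑ p ∈ plaquettesTouching Λ, max 0 (min 1 ((plaqCostAt r.ρ p.1 p.2.1.1 p.2.1.2 W - t') / (t - t'))))
      ((plaquettesTouching Λ).biUnion plaquetteEdges) := by
  intro U V hUV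
  refine Finset.sum_congr rfl fun p hp => ?_
  have h : plaqCostAt r.ρ p.1 p.2.1.1 p.2.1.2 U = plaqCostAt r.ρ p.1 p.2.1.1 p.2.1.2 V :=
    isCylinder_plaqCostAt_plaquette r.ρ p fun e he => hUV e (by
      rw [Finset.coe_biUnion]
      exact Set.mem_biUnion (Finset.mem_coe.2 hp) he)
  rw [h]

omit [CompactSpace G] in
/-- **The ramp dominates the hot event under every kernel**: `γ(coldᶜ) ≤ ∫ Φ dγ` for a probability measure `γ` (`t' < β^{κ−1}`).
[folklore] -/
theorem measureReal_compl_coldEvent_le_integral_ramp [SecondCountableTopology G] (r : LatticeRep G) {β κ t' : ℝ}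
    (htt : t' < β ^ (κ - 1)) (Λ : Finset (QuantumLattice.ZdEdge 4)) (γ : Measure (LGConfig 4 G)) [IsProbabilityMeasure γ] :
    γ.real (coldEvent r β κ Λ)ᶜ ≤ ∫ W, ∑ p ∈ plaquettesTouching Λ,
      max 0 (min 1 ((plaqCostAt r.ρ p.1 p.2.1.1 p.2.1.2 W - t') / (β ^ (κ - 1) - t'))) ∂γ := by
  have hA : MeasurableSet (coldEvent r β κ Λ)ᶜ := (measurableSet_coldEvent r β κ Λ).compl
  rw [← integral_indicator_one hA]
  refine integral_mono ((integrable_const (1 : ℝ)).indicator hA) ?_ fun W => ?_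
  · exact Integrable.of_bound (continuous_ramp r _ t' Λ).measurable.aestronglyMeasurable ((plaquettesTouching Λ).card : ℝ)
      (ae_of_all _ fun W => by rw [Real.norm_eq_abs]; exact abs_ramp_le_card r _ t' Λ W)
  · by_cases hW : W ∈ (coldEvent r β κ Λ)ᶜ
    · rw [Set.indicator_of_mem hW, Pi.one_apply]
      exact one_le_ramp_of_not_mem_coldEvent r htt Λ hW
    · rw [Set.indicator_of_notMem hW]
      exact (ramp_nonneg_le_card r _ t' Λ W).1

end Ramp

/-! ### §9. Markov + DLR: the data whose kernel charges the ramp are torus-rare -/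

section Markov

variable {G : Type} [Group G] [TopologicalSpace G] [IsTopologicalGroup G] [CompactSpace G]
  [MeasurableSpace G] [BorelSpace G]

/-- **Kernel cold-typicality is torus-typical.**  For torus sides `L + 1 > 2(n + 6R + 2)`, `e > 0` and thresholds `t' = β^{2δ'−1}`,
`t`: if every single-plaquette indicator `𝟙{β^{2δ'−1} ≤ c_p}` has torus expectation `≤ e^{−β^{δ'}}` (all sites, all planes `i < j`),
then the torus configurations `U` whose box kernel `γ_{lift U}` charges the ramp `Φ_{t',t}` of the lag box `Λ_n` by more than `e`
have torus mass `≤ 16(2n+3)⁴ e^{−β^{δ'}} / e`: Markov's inequality, the DLR equation `E[γ_{lift}(Φ)] = E[Φ ∘ lift]` (Georgii 2011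
Thm. 4.17), `Φ ≤ Σ_p 𝟙{t' ≤ c_p}` and the union bound over the `≤ 16(2n+3)⁴` plaquettes touching `Λ_n`. [folklore] -/
theorem measureReal_kernelRamp_gt_le (r : LatticeRep G) {β δ' e t : ℝ} {n R L : ℕ} (he : 0 < e)
    (ht : β ^ (2 * δ' - 1) < t) (hL : 2 * (n + 6 * R + 2) < L + 1)
    (hrare : ∀ (x : Site 4) (i j : Fin 4), i < j →
      wilsonExpectation (L := L + 1) r.ρ β
          (toTorusObservable (L + 1) fun U : LGConfig 4 G =>
            if β ^ (2 * δ' - 1) ≤ plaqCostAt r.ρ x i j U then (1 : ℝ) else 0) ≤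
        Real.exp (-(β ^ δ'))) :
    (wilsonMeasure (d := 4) (L := L + 1) r.ρ β).real
        {U : GaugeConfig 4 (L + 1) G | e < ∫ W, ∑ p ∈ plaquettesTouching (lagBox n),
            max 0 (min 1 ((plaqCostAt r.ρ p.1 p.2.1.1 p.2.1.2 W - β ^ (2 * δ' - 1)) / (t - β ^ (2 * δ' - 1))))
            ∂(ymSpecification (d := 4) r.ρ β (lagBox n) (torusLift (L + 1) U))} ≤
      16 * (2 * (n : ℝ) + 3) ^ 4 * Real.exp (-(β ^ δ')) / e := by
  haveI : SecondCountableTopology G := r.secondCountableTopology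
  haveI := isProbabilityMeasure_wilsonMeasure (d := 4) (L := L + 1) (G := G) r.ρ r.continuous β
  set μ := wilsonMeasure (d := 4) (L := L + 1) r.ρ β with hμ
  set Λ : Finset (QuantumLattice.ZdEdge 4) := lagBox n with hΛ
  set t' : ℝ := β ^ (2 * δ' - 1) with ht'
  set Φ : LGConfig 4 G → ℝ := fun W => ∑ p ∈ plaquettesTouching Λ,
      max 0 (min 1 ((plaqCostAt r.ρ p.1 p.2.1.1 p.2.1.2 W - t') / (t - t'))) with hΦ
  set C : ℝ := ((plaquettesTouching Λ).card : ℝ) with hC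
  have hΦc : Continuous Φ := continuous_ramp r t t' Λ
  have hΦK : ∀ W, |Φ W| ≤ C := abs_ramp_le_card r t t' Λ
  have hΦS : IsCylinder Φ ((plaquettesTouching Λ).biUnion plaquetteEdges) := isCylinder_ramp r t t' Λ
  have hml := measurable_torusLift (d := 4) (G := G) (L + 1)
  set g : GaugeConfig 4 (L + 1) G → ℝ := fun U => ∫ W, Φ W ∂(ymSpecification r.ρ β Λ (torusLift (L + 1) U)) with hg
  have hgm : Measurable g := (continuous_integral_ymSpecification r.ρ r.continuous β Λ hΦc hΦK).measurable.comp hml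
  have hg0 : ∀ U, 0 ≤ g U := fun U => integral_nonneg fun W => (ramp_nonneg_le_card r t t' Λ W).1
  have hgK : ∀ U, |g U| ≤ C := fun U => abs_integral_ymSpecification_le r.ρ r.continuous β Λ hΦK _
  have hgi : Integrable g μ :=
    Integrable.of_bound hgm.aestronglyMeasurable C (ae_of_all _ fun U => by rw [Real.norm_eq_abs]; exact hgK U)
  -- Markov
  have hmarkov : e * μ.real {U | e ≤ g U} ≤ ∫ U, g U ∂μ :=
    mul_meas_ge_le_integral_of_nonneg (ae_of_all _ hg0) hgi e
  have hmono : μ.real {U : GaugeConfig 4 (L + 1) G | e < g U} ≤ μ.real {U | e ≤ g U} :=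
    measureReal_mono fun U (hU : e < g U) => hU.le
  -- DLR: `∫ g dμ = ∫ Φ ∘ lift dμ`
  have hT : ∀ e' ∈ Λ ∪ (plaquettesTouching Λ).biUnion plaquetteEdges ∪ (plaquettesTouching Λ).biUnion plaquetteEdges,
      e'.1 ∈ box 4 (n + 6 * R + 2) := by
    intro e' he'
    rcases Finset.mem_union.1 he' with he' | he'
    · exact box_mono 4 (by omega) (fst_mem_box_of_mem_lagBox_union_collar he')
    · exact box_mono 4 (by omega) (fst_mem_box_of_mem_lagBox_union_collar (Finset.mem_union_right _ he'))
  have hinj := injOn_torusProj_image_fst hL hT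
  have hdlr : ∫ U, g U ∂μ = ∫ U, Φ (torusLift (L + 1) U) ∂μ := by
    have h := wilsonExpectation_toTorusObservable_eq r.ρ r.continuous β Λ hΦc hΦK hΦS (L := L + 1) hinj
    simpa only [wilsonExpectation, toTorusObservable, Function.comp_def] using h.symm
  -- term by term: `∫ φ_p ∘ lift ≤ μ{t' ≤ c_p ∘ lift} ≤ e^{-β^{δ'}}`
  have hterm : ∀ p ∈ plaquettesTouching Λ,
      ∫ U, max 0 (min 1 ((plaqCostAt r.ρ p.1 p.2.1.1 p.2.1.2 (torusLift (L + 1) U) - t') / (t - t'))) ∂μ ≤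
        Real.exp (-(β ^ δ')) := by
    intro p _
    set S : Set (GaugeConfig 4 (L + 1) G) := {U | t' ≤ plaqCostAt r.ρ p.1 p.2.1.1 p.2.1.2 (torusLift (L + 1) U)} with hS
    have hSm : MeasurableSet S :=
      measurableSet_le measurable_const ((measurable_plaqCostAtG r.ρ r.continuous _ _ _).comp hml)
    have h1 : ∫ U, max 0 (min 1 ((plaqCostAt r.ρ p.1 p.2.1.1 p.2.1.2 (torusLift (L + 1) U) - t') / (t - t'))) ∂μ ≤
        ∫ U, S.indicator 1 U ∂μ := by
      refine integral_mono_of_nonneg (ae_of_all _ fun U => (rampTerm_mem r t t' p _).1)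
        ((integrable_const (1 : ℝ)).indicator hSm) (ae_of_all _ fun U => ?_)
      have h := rampTerm_le_indicator r ht p (torusLift (L + 1) U)
      simp only [hS, Set.indicator_apply, Set.mem_setOf_eq, Pi.one_apply]
      exact h
    rw [integral_indicator_one hSm] at h1
    refine h1.trans ?_
    rw [hS, measureReal_setOf_le_plaqCostAt_eqG r.ρ r.continuous β t' L p.1 p.2.1.1 p.2.1.2]
    exact hrare p.1 p.2.1.1 p.2.1.2 p.2.2
  have hint : ∀ p ∈ plaquettesTouching Λ, Integrable (fun U : GaugeConfig 4 (L + 1) G =>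
      max 0 (min 1 ((plaqCostAt r.ρ p.1 p.2.1.1 p.2.1.2 (torusLift (L + 1) U) - t') / (t - t')))) μ := by
    intro p _
    refine Integrable.of_bound ?_ 1 (ae_of_all _ fun U => ?_)
    · exact ((continuous_const.max (continuous_const.min (((continuous_plaqCostAtG r.ρ r.continuous p.1 p.2.1.1
        p.2.1.2).sub continuous_const).div_const _))).measurable.comp hml).aestronglyMeasurable
    · rw [Real.norm_eq_abs, abs_of_nonneg (rampTerm_mem r t t' p _).1]
      exact (rampTerm_mem r t t' p _).2
  have hsum : ∫ U, Φ (torusLift (L + 1) U) ∂μ ≤ C * Real.exp (-(β ^ δ')) := by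
    simp only [hΦ]
    rw [integral_finsetSum _ hint]
    refine (Finset.sum_le_sum hterm).trans ?_
    rw [Finset.sum_const, nsmul_eq_mul]
  have hCle : C ≤ 16 * (2 * (n : ℝ) + 3) ^ 4 := card_plaquettesTouching_lagBox_le n
  have hfin : e * μ.real {U : GaugeConfig 4 (L + 1) G | e < g U} ≤ 16 * (2 * (n : ℝ) + 3) ^ 4 * Real.exp (-(β ^ δ')) := by
    have := mul_le_mul_of_nonneg_right hCle (Real.exp_pos (-(β ^ δ'))).le
    nlinarith [hmarkov, hmono, hdlr, hsum, measureReal_nonneg (μ := μ) (s := {U : GaugeConfig 4 (L + 1) G | e < g U})]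
  rw [le_div_iff₀ he, mul_comm]
  exact hfin

end Markov

end Summit.QuantumFields.YangMills.Theorems.SoftLoopLongLag

end
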